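import Summits.BirchSwinnertonDyer.BirchSwinnertonDyer.Theorems.ManinLocalTwoThreeAdditiveDyadicTransport
import Summits.BirchSwinnertonDyer.Rank1Residual.Additive.LegendreTwistRelationOfCharTwist
import Literature.NumberTheory.DiophantineApproximation.SparseDyadicRationals
import HarnessLib

set_option linter.dupNamespace false
set_option autoImplicit false

/-!
# The DYADIC DEPTH SIEVE at `v₂(N) = 6` (es g52; landed by LEAD p1 g25 from `HOME/es/g52/Sketch-es-g52.lean` sha16 bf922ce89e117bd9, T-es-120) (MEMO-es §81; cell bsd-f2-manin, Euler-system / explicit-reciprocity lens)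

KERNEL THEOREMS (this file: rc 0 · 0 sorries · axioms {propext, Classical.choice, Quot.sound}) explaining the observed
law O-80 (MEMO-es §80.5: at the twelve `2 ∤ #W(ℚ)_tors` optimal classes of conductor `3136 = 2⁶·7²` the cusps with image
of even order are EXACTLY the 24 cusps `a/56`, i.e. of 2-depth `j = v₂(den) = 3`; every other cusp maps to `O`).
MECHANISM (Euler-system twist compatibility = Birch's lemma, read on CUSPS instead of on closed paths): for `g = f ⊗ χ`,
`χ ∈ {χ₈, χ₈′}` primitive mod `8`, `f ∈ S₂(Γ₀(N))` with `4 ∣ N` and `a_{2n}(f) = 0`, and every `x ∈ ℚ`: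
  `g(χ)·{∞, x}_g = Σ_{u odd} χ(u){∞, x + u/8}_f = 2({∞, x+⅛}_f + ε{∞, x+⅜}_f)`   (`gaussSum_mul_modularSymbol_charTwist_eq_two_mul`;
  tree: `modularSymbol_charTwist`, `sum_χ₈_mul`, HALF-TRANSLATE `maninLocalTwoThree_modularSymbol_add_half_eq_neg_of_four_dvd`);
and — the new, purely cusp-combinatorial input, PROVED here by EXPLICIT MATRICES in `Γ₀(N)` (§1–§2) — if moreover
`32 ∤ N` and `8 ∣ den(x + ⅜)` (⟺ `v₂(den x) ≠ 3`), then `x+⅛ ~ x+⅜` under `Γ₀(N)` (E-es-297,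
`modularSymbol_sub_quarter_sub_mem_periodLattice_of_eight_dvd`) and `x+⅜` is fixed by `τ ↦ τ+½`, so `2{∞,x+⅜}_f ∈ Λ_f`
(E-es-298, `two_mul_modularSymbol_mem_periodLattice_of_eight_dvd`; an's E-an-80 made explicit).  Hence
`g(χ)·{∞, x}_g ∈ 2Λ_f` (E-es-299 `dyadicDepthSieve_holds`), and on an ALIGNED twist pair of curves
(`Λ_W = (g(χ)/2)⁻¹Λ_A`, the `r = 1` case of the cell's `neronLattice_mem_iff_of_twist_of_sq_eq`, with `c(D_A) ∣ c(D_W)`)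
the cusp `x` maps to `O ∈ W(ℂ)` (E-es-300 `dyadicDepthSieveOnCurve_holds`).  At ALL cusps the display TRANSPORTS torsion
exponents: `exp C(W) ∣ exp C(A)` for the cuspidal image groups (E-es-301 `torsionExponent_transport_of_alignedTwist`).
CENSUS (BC5 witness; engines `HOME/es/g52/{depthlaw,depth3,halftrans}.py` over the cell's per-cusp tables
`es/g51/locate80-rows.tsv` + Cremona `allcurves`): 78 optimal classes of conductor `64M ≤ 3136` with per-cusp image orders;
42 have an OPTIMAL `χ±8`-partner `A` at `2`-level `k ∈ {2,3,4}`: 40 ALIGNED (twist defect `1`; theorem bound «order 1 off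
2-depth 3») + 2 of defect `2` (`704a1`, `704k1 ← 176b1`; bound 2) — observed order 1 at all 1 048 + 8 tabulated cusps of
2-depth `≠ 3` (0 exceptions; the 464 depth-3 rows carry every even order); exponent transport «ord φ_W(s) ∣ exp C(A)» 46/46
partner tests (14 at `448` incl. the `k = 5` partners `224a/b`, 8 at `576`, 24 at `3136`), 0 violations, equality in the 38
tests at `448`, `3136`; half-translation law at all `v₂(N) ≥ 2`: 6 830 `t`-fixed cusp rows in 831 classes, all of order 1 or 2
(568 non-fixed control rows of order > 2); alignment census (E-es-302, `align2.py` over all 64 687 curves `N < 10⁴`, both signs):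
`v₂(N_A) ∈ {2,3} ⟹` the `±2`-twist is aligned, 20 280 / 20 280 (at `v₂(N_A) = 4`: 13 552 / 14 134, e.g. `176b1 → 704a1` is not).
Nothing here proves C2, C3, Manin's conjecture or BSD.
-/

noncomputable section

open scoped MatrixGroups ModularForm
open CongruenceSubgroup

namespace Summit.BirchSwinnertonDyer.BirchSwinnertonDyer.Theorems.ManinLocalTwoThreeDyadicDepthSieve

open Literature.NumberTheory.EllipticCurves Literature.NumberTheory.EllipticCurves.ModularForms
open Summit.BirchSwinnertonDyer.BirchSwinnertonDyer.Theorems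
open Summit.BirchSwinnertonDyer.Rank1Residual.Additive Summit.BirchSwinnertonDyer.Rank1Residual.ManinAdditive

/-- `χ₈ = (2/·)` (Mathlib `ZMod.χ₈`) has the character-sum shape `Σ_u χ(u)F(u) = F1 + εF3 − F5 − εF7` with `ε = −1` (tree: `sum_χ₈_mul`). -/
theorem eightSumShape_χ₈ :
    ∀ F : ZMod 8 → ℂ, ∑ u : ZMod 8, ZMod.χ₈.ringHomComp (Int.castRingHom ℂ) u * F u =
      F 1 + ((-1 : ℤ) : ℂ) * F 3 - F 5 - ((-1 : ℤ) : ℂ) * F 7 := by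
  intro F
  rw [sum_χ₈_mul]
  push_cast
  ring

/-- `χ₈′ = (−2/·)` (Mathlib `ZMod.χ₈'`) has the character-sum shape with `ε = 1` (tree: `sum_χ₈'_mul`). -/
theorem eightSumShape_χ₈' :
    ∀ F : ZMod 8 → ℂ, ∑ u : ZMod 8, ZMod.χ₈'.ringHomComp (Int.castRingHom ℂ) u * F u =
      F 1 + ((1 : ℤ) : ℂ) * F 3 - F 5 - ((1 : ℤ) : ℂ) * F 7 := by
  intro F
  rw [sum_χ₈'_mul]
  push_cast
  ring

/-! ### §1  Explicit cusp transport (the constructive half of Cremona's Prop. 2.2.3, same denominator) -/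

/-- **Explicit cusp transport.**  If `p v − u q = 1`, `p' w − s q = 1` and `N ∣ q(v − w)`, then
`γ = (p' s; q w)·(p u; q v)⁻¹ = (p'v − sq, sp − p'u; qv − wq, wp − qu) ∈ Γ₀(N)` maps `p/q ↦ p'/q`, so Manin's relation
`{∞, γr}_f = {∞, γ∞}_f + {∞, r}_f` (`modularSymbol_gamma0_smul_holds`) gives `{∞,p'/q}_f − {∞,p/q}_f ∈ Λ_f`.
[cite: Cremona1997, Prop. 2.2.3] [cite: Manin1972, §1.2] -/
theorem modularSymbol_sub_mem_periodLattice_of_matrixData {N : ℕ} [NeZero N] (f : CuspForm (Gamma0 N) 2)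
    (p q p' u v s w : ℤ) (hq : q ≠ 0) (h1 : p * v - u * q = 1) (h2 : p' * w - s * q = 1)
    (hC : (N : ℤ) ∣ q * v - w * q) :
    modularSymbol f ((p' : ℚ) / q) - modularSymbol f ((p : ℚ) / q) ∈ periodLattice f := by
  let γM : SL(2, ℤ) := ⟨!![p' * v - s * q, s * p - p' * u; q * v - w * q, w * p - q * u], by
    rw [Matrix.det_fin_two_of]; linear_combination (p * v - u * q) * h2 + h1⟩
  have hγM : γM ∈ Gamma0 N := Gamma0_mem.mpr (by
    show ((q * v - w * q : ℤ) : ZMod N) = 0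
    exact (ZMod.intCast_zmod_eq_zero_iff_dvd _ N).mpr hC)
  have h00 : (((⟨γM, hγM⟩ : Gamma0 N) : SL(2, ℤ)) 0 0 : ℤ) = p' * v - s * q := rfl
  have h01 : (((⟨γM, hγM⟩ : Gamma0 N) : SL(2, ℤ)) 0 1 : ℤ) = s * p - p' * u := rfl
  have h10 : (((⟨γM, hγM⟩ : Gamma0 N) : SL(2, ℤ)) 1 0 : ℤ) = q * v - w * q := rfl
  have h11 : (((⟨γM, hγM⟩ : Gamma0 N) : SL(2, ℤ)) 1 1 : ℤ) = w * p - q * u := rfl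
  have hq' : (q : ℚ) ≠ 0 := by exact_mod_cast hq
  have h1q : (p : ℚ) * v - u * q = 1 := by exact_mod_cast h1
  have hden1 : ((q * v - w * q : ℤ) : ℚ) * ((p : ℚ) / q) + ((w * p - q * u : ℤ) : ℚ) = 1 := by
    push_cast
    field_simp
    linear_combination h1q
  have hnum : ((p' * v - s * q : ℤ) : ℚ) * ((p : ℚ) / q) + ((s * p - p' * u : ℤ) : ℚ) = (p' : ℚ) / q := by
    rw [eq_div_iff hq']
    push_cast
    field_simp
    linear_combination (p' : ℚ) * h1q
  have h := modularSymbol_gamma0_smul_holds f ⟨γM, hγM⟩ ((p : ℚ) / q)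
    (by rw [h10, h11, hden1]; exact one_ne_zero)
  rw [h00, h01, h10, h11, hden1, hnum, div_one] at h
  rw [h, add_sub_cancel_right]
  exact cuspSymbol_mem_periodLattice f _

/-- `8 ∣ z² − 1` for odd `z`. -/
theorem eight_dvd_sq_sub_one_of_odd {z : ℤ} (hz : Odd z) : ∃ t : ℤ, z ^ 2 - 1 = 8 * t := by
  obtain ⟨y, rfl⟩ := hz
  obtain ⟨x, hx⟩ := Int.even_mul_succ_self y
  exact ⟨x, by linear_combination 4 * hx⟩

/-- From `N ≠ 0`, `¬ 2⁵ ∣ N`: `N = 2^k·m` with `m` odd and `2^k ∣ 16`. -/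
theorem exists_two_pow_mul_odd_of_not_dvd {N : ℕ} (hN : N ≠ 0) (h32 : ¬ 2 ^ 5 ∣ N) :
    ∃ (k : ℕ) (m : ℕ), Odd m ∧ N = 2 ^ k * m ∧ (2 : ℤ) ^ k ∣ 16 := by
  obtain ⟨k, m, hm, hNkm⟩ := Nat.exists_eq_two_pow_mul_odd hN
  have hk : k ≤ 4 := by
    by_contra hk
    rw [not_le] at hk
    exact h32 (hNkm ▸ Dvd.dvd.mul_right (pow_dvd_pow 2 hk) m)
  refine ⟨k, m, hm, hNkm, ?_⟩
  have : (2 : ℤ) ^ k ∣ 2 ^ 4 := pow_dvd_pow 2 hk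
  simpa using this

/-- From `N ≠ 0`, `¬ 2⁶ ∣ N`: `N = 2^k·m` with `m` odd and `2^k ∣ 32`. -/
theorem exists_two_pow_mul_odd_of_not_dvd_sixtyFour {N : ℕ} (hN : N ≠ 0) (h64 : ¬ 2 ^ 6 ∣ N) :
    ∃ (k : ℕ) (m : ℕ), Odd m ∧ N = 2 ^ k * m ∧ (2 : ℤ) ^ k ∣ 32 := by
  obtain ⟨k, m, hm, hNkm⟩ := Nat.exists_eq_two_pow_mul_odd hN
  have hk : k ≤ 5 := by
    by_contra hk
    rw [not_le] at hk
    exact h64 (hNkm ▸ Dvd.dvd.mul_right (pow_dvd_pow 2 hk) m)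
  refine ⟨k, m, hm, hNkm, ?_⟩
  have : (2 : ℤ) ^ k ∣ 2 ^ 5 := pow_dvd_pow 2 hk
  simpa using this

/-! ### §2  The two cusp lemmas at a cusp `p/q` with `8 ∣ q` on `X₀(N)`, `4 ∣ N`, `32 ∤ N` (E-es-298: `64 ∤ N`) -/

/-- **E-es-298 (THEOREM; an's E-an-80 made explicit at every cusp of denominator divisible by `8`):**
`4 ∣ N`, `64 ∤ N`, vanishing even coefficients, `p/q` in lowest terms with `8 ∣ q` ⟹ `2{∞, p/q}_f ∈ Λ_f`
(the cusp `p/q` is fixed by `τ ↦ τ + ½` iff `2v₂(q) ≥ v₂(N) + 1`; here `v₂(q) ≥ 3`, `v₂(N) ≤ 5`).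
Witness: `p' = p + q/2`, `v = a`, `u = −b` (Bezout `ap + bq = 1`), `w = a + (q/2)m` (`m` = odd part of `N`); then
`{∞, p/q + ½} − {∞, p/q} ∈ Λ_f` by §1 and `{∞, p/q + ½} = −{∞, p/q}` by HALF-TRANSLATE. -/
theorem two_mul_modularSymbol_mem_periodLattice_of_eight_dvd {N : ℕ} [NeZero N] (f : CuspForm (Gamma0 N) 2)
    (h4 : 4 ∣ N) (h64 : ¬ 2 ^ 6 ∣ N) (heven : ∀ n : ℕ, 2 ∣ n → cuspCoeff f n = 0)
    (p q : ℤ) (hq : q ≠ 0) (hpq : IsCoprime p q) (h8 : 8 ∣ q) :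
    2 * modularSymbol f ((p : ℚ) / q) ∈ periodLattice f := by
  obtain ⟨q₈, rfl⟩ := h8
  obtain ⟨k, m, hm, hNkm, e, he⟩ := exists_two_pow_mul_odd_of_not_dvd_sixtyFour (NeZero.ne N) h64
  obtain ⟨a, b, hab⟩ := hpq
  have hodd1 : Odd (a * p + b * (8 * q₈)) := by rw [hab]; exact odd_one
  have hap : Odd (a * p) := (Int.odd_add.mp hodd1).mpr ⟨b * 4 * q₈, by ring⟩
  have ha : Odd a := (Int.odd_mul.mp hap).1
  have hp : Odd p := (Int.odd_mul.mp hap).2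
  have hm' : Odd (m : ℤ) := by exact_mod_cast hm
  obtain ⟨t, ht⟩ := Odd.add_odd (hp.mul hm') ha
  have key := modularSymbol_sub_mem_periodLattice_of_matrixData f p (8 * q₈) (p + 4 * q₈) (-b) a
    (-b + t + 2 * q₈ * m) (a + 4 * q₈ * m) hq (by linear_combination hab)
    (by linear_combination hab + 4 * q₈ * ht)
    ⟨-(e * q₈ ^ 2), by rw [hNkm]; push_cast; linear_combination (-(q₈ ^ 2 * (m : ℤ))) * he⟩
  have hq' : ((8 * q₈ : ℤ) : ℚ) ≠ 0 := by exact_mod_cast hq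
  rw [show (((p + 4 * q₈ : ℤ)) : ℚ) / ((8 * q₈ : ℤ) : ℚ) = (p : ℚ) / ((8 * q₈ : ℤ) : ℚ) + 1 / 2 by
      field_simp; push_cast; ring,
    maninLocalTwoThree_modularSymbol_add_half_eq_neg_of_four_dvd f h4 heven] at key
  rw [show (2 : ℂ) * modularSymbol f ((p : ℚ) / ((8 * q₈ : ℤ) : ℚ)) =
      -(-modularSymbol f ((p : ℚ) / ((8 * q₈ : ℤ) : ℚ)) - modularSymbol f ((p : ℚ) / ((8 * q₈ : ℤ) : ℚ))) by ring]
  exact neg_mem key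

/-- **E-es-297 (THEOREM; the cusp-class lemma):** `4 ∣ N`, `32 ∤ N`, `p/q` in lowest terms with `8 ∣ q` ⟹ the cusps
`p/q − ¼` and `p/q` are `Γ₀(N)`-equivalent: `{∞, p/q − ¼}_f − {∞, p/q}_f ∈ Λ_f`.  Witness: `p' = p − q/4`, `v = a`, `u = −b`,
`w = a + (q/4)·m²ap'`.  (False for `32 ∣ N`: at `k = 5` the two cusps separate — the `64M ↔ 2048M` step has no sieve.) -/
theorem modularSymbol_sub_quarter_sub_mem_periodLattice_of_eight_dvd {N : ℕ} [NeZero N]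
    (f : CuspForm (Gamma0 N) 2) (h32 : ¬ 2 ^ 5 ∣ N)
    (p q : ℤ) (hq : q ≠ 0) (hpq : IsCoprime p q) (h8 : 8 ∣ q) :
    modularSymbol f ((p : ℚ) / q - 1 / 4) - modularSymbol f ((p : ℚ) / q) ∈ periodLattice f := by
  obtain ⟨q₈, rfl⟩ := h8
  obtain ⟨k, m, hm, hNkm, e, he⟩ := exists_two_pow_mul_odd_of_not_dvd (NeZero.ne N) h32
  obtain ⟨a, b, hab⟩ := hpq
  have hodd1 : Odd (a * p + b * (8 * q₈)) := by rw [hab]; exact odd_one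
  have hap : Odd (a * p) := (Int.odd_add.mp hodd1).mpr ⟨b * 4 * q₈, by ring⟩
  have ha : Odd a := (Int.odd_mul.mp hap).1
  have hp : Odd p := (Int.odd_mul.mp hap).2
  have hm' : Odd (m : ℤ) := by exact_mod_cast hm
  have hp' : Odd (p - 2 * q₈) := by
    have : p - 2 * q₈ = p + 2 * (-q₈) := by ring
    rw [this]; exact hp.add_even ⟨-q₈, by ring⟩
  obtain ⟨t, ht⟩ := eight_dvd_sq_sub_one_of_odd (hp'.mul hm')
  have key := modularSymbol_sub_mem_periodLattice_of_matrixData f p (8 * q₈) (p - 2 * q₈) (-b) a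
    (-b + 2 * a * t) (a + 2 * q₈ * ((m : ℤ) ^ 2 * a * (p - 2 * q₈))) hq (by linear_combination hab)
    (by linear_combination hab + 2 * q₈ * a * ht)
    ⟨-(e * q₈ ^ 2 * ((m : ℤ) * a * (p - 2 * q₈))), by
      rw [hNkm]; push_cast; linear_combination (-(q₈ ^ 2 * ((m : ℤ) ^ 2 * a * (p - 2 * q₈)))) * he⟩
  have hq' : ((8 * q₈ : ℤ) : ℚ) ≠ 0 := by exact_mod_cast hq
  rwa [show (((p - 2 * q₈ : ℤ)) : ℚ) / ((8 * q₈ : ℤ) : ℚ) = (p : ℚ) / ((8 * q₈ : ℤ) : ℚ) - 1 / 4 by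
      field_simp; push_cast; ring] at key

/-- **E-es-297 at the translates `x + ⅛ ~ x + ⅜`** (`8 ∣ den(x + ⅜)` ⟺ `v₂(den x) ≠ 3`, MEMO-es §81.2). -/
theorem modularSymbol_add_eighth_sub_mem_periodLattice {N : ℕ} [NeZero N] (f : CuspForm (Gamma0 N) 2)
    (h32 : ¬ 2 ^ 5 ∣ N) (x : ℚ) (hx : 8 ∣ (x + 3 / 8).den) :
    modularSymbol f (x + 1 / 8) - modularSymbol f (x + 3 / 8) ∈ periodLattice f := by
  have h := modularSymbol_sub_quarter_sub_mem_periodLattice_of_eight_dvd f h32 (x + 3 / 8).num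
    ((x + 3 / 8).den : ℤ) (by exact_mod_cast (x + 3 / 8).den_nz) (Literature.NumberTheory.DiophantineApproximation.isCoprime_num_den _)
    (by exact_mod_cast hx)
  rwa [Int.cast_natCast, Rat.num_div_den, show x + 3 / 8 - 1 / 4 = x + 1 / 8 by ring] at h

/-- **E-es-298 at the translate `x + ⅜`**. -/
theorem two_mul_modularSymbol_add_three_eighths_mem_periodLattice {N : ℕ} [NeZero N]
    (f : CuspForm (Gamma0 N) 2) (h4 : 4 ∣ N) (h64 : ¬ 2 ^ 6 ∣ N)
    (heven : ∀ n : ℕ, 2 ∣ n → cuspCoeff f n = 0) (x : ℚ) (hx : 8 ∣ (x + 3 / 8).den) :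
    2 * modularSymbol f (x + 3 / 8) ∈ periodLattice f := by
  have h := two_mul_modularSymbol_mem_periodLattice_of_eight_dvd f h4 h64 heven (x + 3 / 8).num
    ((x + 3 / 8).den : ℤ) (by exact_mod_cast (x + 3 / 8).den_nz) (Literature.NumberTheory.DiophantineApproximation.isCoprime_num_den _)
    (by exact_mod_cast hx)
  rwa [Int.cast_natCast, Rat.num_div_den] at h

/-! ### §3  The dyadic depth sieve (E-es-299) and its curve form (E-es-300) — THEOREMS -/

/-! ### Glue (PROVED) -/

/-- The twisted symbol PAIRS UP under HALF-TRANSLATE: `g(χ)·{∞, x}_{f⊗χ} = 2({∞, x+⅛}_f + ε{∞, x+⅜}_f)` for `4 ∣ N` and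
vanishing even coefficients (tree: `modularSymbol_charTwist` + `maninLocalTwoThree_modularSymbol_add_half_eq_neg_of_four_dvd`). -/
theorem gaussSum_mul_modularSymbol_charTwist_eq_two_mul {N : ℕ} [NeZero N] (f : CuspForm (Gamma0 N) 2)
    (h4 : 4 ∣ N) (heven : ∀ n : ℕ, 2 ∣ n → cuspCoeff f n = 0)
    (L : ℕ) [NeZero L] (hN : N ∣ L) (hm : 8 ^ 2 ∣ L) {χ : DirichletCharacter ℂ 8} (hχ : χ.IsQuadratic)
    (hprim : χ.IsPrimitive) {ε : ℤ} (hsum : ∀ F : ZMod 8 → ℂ, ∑ u : ZMod 8, χ u * F u = F 1 + (ε : ℂ) * F 3 - F 5 - (ε : ℂ) * F 7) (x : ℚ) :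
    gaussSum χ (ZMod.stdAddChar (N := 8)) * modularSymbol (charTwist L hN hm hχ f) x =
      2 * (modularSymbol f (x + 1 / 8) + ε * modularSymbol f (x + 3 / 8)) := by
  have hG : gaussSum χ (ZMod.stdAddChar (N := 8)) ≠ 0 := gaussSum_stdAddChar_ne_zero_of_isPrimitive hprim
  have hhalf : ∀ r : ℚ, modularSymbol f (r + 1 / 2) = -modularSymbol f r :=
    maninLocalTwoThree_modularSymbol_add_half_eq_neg_of_four_dvd f h4 heven
  rw [ModularForms.modularSymbol_charTwist L hN hm hχ f x, ← mul_assoc, mul_inv_cancel₀ hG, one_mul,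
    hsum (fun u ↦ modularSymbol f (x + twistShift u)), twistShift_one_eight, twistShift_three_eight,
    twistShift_five_eight, twistShift_seven_eight, show x + 5 / 8 = x + 1 / 8 + 1 / 2 by ring,
    show x + 7 / 8 = x + 3 / 8 + 1 / 2 by ring, hhalf, hhalf]
  ring

/-- **E-es-299 `DyadicDepthSieve`** (MEMO-es §81.3): for `f ∈ S₂(Γ₀(N))` with `4 ∣ N`,
`32 ∤ N` and vanishing even coefficients, `χ` primitive quadratic mod `8` with `Σ_u χ(u)F(u) = F1 + εF3 − F5 − εF7`, and
every cusp `x` with `8 ∣ den(x + ⅜)` (⟺ 2-depth `v₂(den x) ≠ 3`):  `g(χ)·{∞, x}_{f ⊗ χ} ∈ 2Λ_f`.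
PROOF: **E-es-299 holds** (MEMO-es §81.3): `2({∞,x+⅛} + ε{∞,x+⅜}) = 2({∞,x+⅛} − {∞,x+⅜}) + (1+ε)·2{∞,x+⅜}`. -/
theorem dyadicDepthSieve_holds :
  ∀ (N : ℕ) [NeZero N] (f : CuspForm (Gamma0 N) 2), 4 ∣ N → ¬ 2 ^ 5 ∣ N →
    (∀ n : ℕ, 2 ∣ n → cuspCoeff f n = 0) →
    ∀ (L : ℕ) [NeZero L] (hN : N ∣ L) (hm : 8 ^ 2 ∣ L) (χ : DirichletCharacter ℂ 8) (hχ : χ.IsQuadratic),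
      χ.IsPrimitive → ∀ (ε : ℤ), (ε = 1 ∨ ε = -1) →
      (∀ F : ZMod 8 → ℂ, ∑ u : ZMod 8, χ u * F u = F 1 + (ε : ℂ) * F 3 - F 5 - (ε : ℂ) * F 7) →
    ∀ x : ℚ, 8 ∣ (x + 3 / 8).den →
      ∃ w ∈ periodLattice f,
        gaussSum χ (ZMod.stdAddChar (N := 8)) * modularSymbol (charTwist L hN hm hχ f) x = 2 * w := by
  intro N _ f h4 h32 heven L _ hN hm χ hχ hprim ε hε hsum x hx
  have h1 := modularSymbol_add_eighth_sub_mem_periodLattice f h32 x hx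
  have h2 := two_mul_modularSymbol_add_three_eighths_mem_periodLattice f h4
    (fun h64 ↦ h32 (dvd_trans (pow_dvd_pow 2 (by norm_num)) h64)) heven x hx
  rw [gaussSum_mul_modularSymbol_charTwist_eq_two_mul f h4 heven L hN hm hχ hprim hsum]
  rcases hε with rfl | rfl
  · refine ⟨(modularSymbol f (x + 1 / 8) - modularSymbol f (x + 3 / 8)) + 2 * modularSymbol f (x + 3 / 8),
      add_mem h1 h2, ?_⟩
    push_cast
    ring
  · refine ⟨modularSymbol f (x + 1 / 8) - modularSymbol f (x + 3 / 8), h1, ?_⟩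
    push_cast
    ring

/-- **E-es-300 `DyadicDepthSieveOnCurve`** (the explanation of O-80, MEMO-es §81.4): `A` with an `X₀(N)`-datum `D` (`4 ∣ N`, `32 ∤ N`, even coefficients of `f_A` vanish), `W` with an `X₀(L)`-datum `D'`
whose newform is the `χ`-twist of `f_A` (`χ` primitive quadratic mod `8`), Néron lattices ALIGNED `Λ_W = (g(χ)/2)⁻¹Λ_A` (the
`r = 1` case of the cell's `neronLattice_mem_iff_of_twist_of_sq_eq`) and `c(D) ∣ c(D')`.  Then every cusp `x` with
`8 ∣ den(x + ⅜)` maps to `O ∈ W`: `c(D')·{∞, x}_{f_W} ∈ Λ_W` — the cuspidal image group of `W` is generated by the images of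
the cusps of 2-depth `3` (O-80: 12/12 classes at `3136`; census 42/42 classes `64M ≤ 3136`, 0 exceptional cusps).
PROOF: **E-es-300 holds** (MEMO-es §81.4): read `f_W = f_A ⊗ χ` at level `64N` (`modularSymbol_eq_of_forall_cuspCoeff_eq`,
`cuspCoeff_charTwist`), then `(g/2)·c(D')·{∞,x}_{f_W} = c(D')·w = (c(D')/c(D))·(c(D)·w) ∈ Λ_A` (`smul_periodLattice_le`). -/
theorem dyadicDepthSieveOnCurve_holds :
  ∀ (A : WeierstrassCurve ℚ) [A.IsElliptic] (N : ℕ) [NeZero N] (D : ModularParametrizationData A N)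
    (W : WeierstrassCurve ℚ) [W.IsElliptic] (L : ℕ) [NeZero L] (D' : ModularParametrizationData W L),
    4 ∣ N → ¬ 2 ^ 5 ∣ N → (∀ n : ℕ, 2 ∣ n → cuspCoeff D.f n = 0) →
    ∀ (χ : DirichletCharacter ℂ 8), χ.IsQuadratic → χ.IsPrimitive → ∀ ε : ℤ, (ε = 1 ∨ ε = -1) →
      (∀ F : ZMod 8 → ℂ, ∑ u : ZMod 8, χ u * F u = F 1 + (ε : ℂ) * F 3 - F 5 - (ε : ℂ) * F 7) →
    (∀ n : ℕ, cuspCoeff D'.f n = χ n * cuspCoeff D.f n) →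
    (∀ z : ℂ, z ∈ D'.L.lattice ↔ gaussSum χ (ZMod.stdAddChar (N := 8)) / 2 * z ∈ D.L.lattice) →
    D.c ∣ D'.c →
    ∀ x : ℚ, 8 ∣ (x + 3 / 8).den → (D'.c : ℂ) * modularSymbol D'.f x ∈ D'.L.lattice := by
  intro A _ N _ D W _ L _ D' h4 h32 heven χ hχ hprim ε hε hsum hf hLC hcc x hx
  haveI : NeZero (64 * N) := ⟨mul_ne_zero (by norm_num) (NeZero.ne N)⟩
  have hN : N ∣ 64 * N := dvd_mul_left N 64
  have hm : 8 ^ 2 ∣ 64 * N := ⟨N, by norm_num⟩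
  have hsym : modularSymbol D'.f x = modularSymbol (charTwist (64 * N) hN hm hχ D.f) x :=
    modularSymbol_eq_of_forall_cuspCoeff_eq D'.f (charTwist (64 * N) hN hm hχ D.f)
      (fun n ↦ by rw [hf n, cuspCoeff_charTwist (64 * N) hN hm hχ hprim D.f n]) _
  obtain ⟨w, hw, hgw⟩ := dyadicDepthSieve_holds N D.f h4 h32 heven (64 * N) hN hm χ hχ hprim ε hε hsum x hx
  obtain ⟨q, hq⟩ := hcc
  rw [hLC, hsym, show gaussSum χ (ZMod.stdAddChar (N := 8)) / 2 * ((D'.c : ℂ) *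
      modularSymbol (charTwist (64 * N) hN hm hχ D.f) x) =
      (D'.c : ℂ) * (gaussSum χ (ZMod.stdAddChar (N := 8)) *
        modularSymbol (charTwist (64 * N) hN hm hχ D.f) x) / 2 by ring, hgw, hq]
  push_cast
  rw [show (D.c : ℂ) * (q : ℂ) * (2 * w) / 2 = (q : ℂ) * ((D.c : ℂ) * w) by ring, ← zsmul_eq_mul]
  exact zsmul_mem (D.smul_periodLattice_le w hw) q

/-- **E-es-301 (PROVED) — exponent transport along an aligned twist** (MEMO-es §81.5): with `A, D, W, D'` as in
`DyadicDepthSieveOnCurve` but WITHOUT the conditions `32 ∤ N`, `v₂(c) ≠ 3`: if an integer `m` kills every cusp image of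
`A` (`m·c(D)·{∞,r}_{f_A} ∈ Λ_A` for all `r`), it kills every cusp image of `W`.  Hence `exp C(W) ∣ exp C(A)` for the
cuspidal IMAGE groups (census depth3.out: `ord φ_W(s) ∣ m_A` in 46/46 partner tests, all cusps; equality `= m_A` at the
depth-3 cusps in the 38 tests at `448`, `3136`, strict in the 8 tests at `576`).  Proof: `(g/2)·m·c(D')·{∞,r}_{f_W} = q·m·c(D)·({∞,r+⅛} + ε{∞,r+⅜})_{f_A}`. -/
theorem torsionExponent_transport_of_alignedTwist
    (A : WeierstrassCurve ℚ) [A.IsElliptic] (N : ℕ) [NeZero N] (D : ModularParametrizationData A N)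
    (W : WeierstrassCurve ℚ) [W.IsElliptic] (L : ℕ) [NeZero L] (D' : ModularParametrizationData W L)
    (h4 : 4 ∣ N) (heven : ∀ n : ℕ, 2 ∣ n → cuspCoeff D.f n = 0)
    (χ : DirichletCharacter ℂ 8) (hχ : χ.IsQuadratic) (hprim : χ.IsPrimitive) (ε : ℤ) (hsum : ∀ F : ZMod 8 → ℂ, ∑ u : ZMod 8, χ u * F u = F 1 + (ε : ℂ) * F 3 - F 5 - (ε : ℂ) * F 7)
    (hf : ∀ n : ℕ, cuspCoeff D'.f n = χ n * cuspCoeff D.f n)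
    (hLC : ∀ z : ℂ, z ∈ D'.L.lattice ↔ gaussSum χ (ZMod.stdAddChar (N := 8)) / 2 * z ∈ D.L.lattice)
    (hcc : D.c ∣ D'.c) (m : ℤ) (hkill : ∀ r : ℚ, (m : ℂ) * ((D.c : ℂ) * modularSymbol D.f r) ∈ D.L.lattice)
    (r : ℚ) : (m : ℂ) * ((D'.c : ℂ) * modularSymbol D'.f r) ∈ D'.L.lattice := by
  haveI : NeZero (64 * N) := ⟨mul_ne_zero (by norm_num) (NeZero.ne N)⟩
  have hN : N ∣ 64 * N := dvd_mul_left N 64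
  have hm : 8 ^ 2 ∣ 64 * N := ⟨N, by norm_num⟩
  have hsym : modularSymbol D'.f r = modularSymbol (charTwist (64 * N) hN hm hχ D.f) r :=
    modularSymbol_eq_of_forall_cuspCoeff_eq D'.f (charTwist (64 * N) hN hm hχ D.f)
      (fun n ↦ by rw [hf n, cuspCoeff_charTwist (64 * N) hN hm hχ hprim D.f n]) _
  have hpair := gaussSum_mul_modularSymbol_charTwist_eq_two_mul D.f h4 heven (64 * N) hN hm hχ hprim hsum r
  obtain ⟨q, hq⟩ := hcc
  rw [hLC, hsym, show gaussSum χ (ZMod.stdAddChar (N := 8)) / 2 * ((m : ℂ) * ((D'.c : ℂ) *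
      modularSymbol (charTwist (64 * N) hN hm hχ D.f) r)) =
      (m : ℂ) * (D'.c : ℂ) * (gaussSum χ (ZMod.stdAddChar (N := 8)) *
        modularSymbol (charTwist (64 * N) hN hm hχ D.f) r) / 2 by ring, hpair, hq]
  have h1 := zsmul_mem (hkill (r + 1 / 8)) q
  have h2 := zsmul_mem (hkill (r + 3 / 8)) (q * ε)
  rw [zsmul_eq_mul] at h1 h2
  push_cast at h2 ⊢
  rw [show (m : ℂ) * ((D.c : ℂ) * (q : ℂ)) * (2 * (modularSymbol D.f (r + 1 / 8) + (ε : ℂ) * modularSymbol D.f (r + 3 / 8))) / 2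
      = (q : ℂ) * ((m : ℂ) * ((D.c : ℂ) * modularSymbol D.f (r + 1 / 8)))
        + (q : ℂ) * (ε : ℂ) * ((m : ℂ) * ((D.c : ℂ) * modularSymbol D.f (r + 3 / 8))) by ring]
  exact add_mem h1 h2

/-- **E-es-301r (PROVED) — exponent transport with TWIST DEFECT `r`** (MEMO-es §81.5 (i)): as E-es-301 but with the
general lattice relation `z ∈ Λ_W ↔ (g(χ)/2)·r⁻¹·z ∈ Λ_A` — literally the shape of the cell's
`neronLattice_mem_iff_of_twist_of_sq_eq` (`s = g(χ)/2`, `s² = d = χ(−1)·2`, `r¹²Δ(W) = d⁶Δ(A)`).  If `m` kills every cusp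
image of `A` then `r·m` kills every cusp image of `W`: `exp C(W) ∣ r·exp C(A)` (census: the two defect-2 classes
`704a1, 704k1 ← 176b1`, bound 2, observed order 1 at all 8 tabulated cusps). -/
theorem torsionExponent_transport_of_twist_defect
    (A : WeierstrassCurve ℚ) [A.IsElliptic] (N : ℕ) [NeZero N] (D : ModularParametrizationData A N)
    (W : WeierstrassCurve ℚ) [W.IsElliptic] (L : ℕ) [NeZero L] (D' : ModularParametrizationData W L)
    (h4 : 4 ∣ N) (heven : ∀ n : ℕ, 2 ∣ n → cuspCoeff D.f n = 0)
    (χ : DirichletCharacter ℂ 8) (hχ : χ.IsQuadratic) (hprim : χ.IsPrimitive) (ε : ℤ) (hsum : ∀ F : ZMod 8 → ℂ, ∑ u : ZMod 8, χ u * F u = F 1 + (ε : ℂ) * F 3 - F 5 - (ε : ℂ) * F 7)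
    (hf : ∀ n : ℕ, cuspCoeff D'.f n = χ n * cuspCoeff D.f n) {r : ℚ} (hr : r ≠ 0)
    (hLC : ∀ z : ℂ, z ∈ D'.L.lattice ↔
      gaussSum χ (ZMod.stdAddChar (N := 8)) / 2 * (((r : ℚ) : ℂ)⁻¹ * z) ∈ D.L.lattice)
    (hcc : D.c ∣ D'.c) (m : ℤ) (hkill : ∀ x : ℚ, (m : ℂ) * ((D.c : ℂ) * modularSymbol D.f x) ∈ D.L.lattice)
    (x : ℚ) : ((r : ℚ) : ℂ) * ((m : ℂ) * ((D'.c : ℂ) * modularSymbol D'.f x)) ∈ D'.L.lattice := by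
  haveI : NeZero (64 * N) := ⟨mul_ne_zero (by norm_num) (NeZero.ne N)⟩
  have hN : N ∣ 64 * N := dvd_mul_left N 64
  have hm : 8 ^ 2 ∣ 64 * N := ⟨N, by norm_num⟩
  have hsym : modularSymbol D'.f x = modularSymbol (charTwist (64 * N) hN hm hχ D.f) x :=
    modularSymbol_eq_of_forall_cuspCoeff_eq D'.f (charTwist (64 * N) hN hm hχ D.f)
      (fun n ↦ by rw [hf n, cuspCoeff_charTwist (64 * N) hN hm hχ hprim D.f n]) _
  have hpair := gaussSum_mul_modularSymbol_charTwist_eq_two_mul D.f h4 heven (64 * N) hN hm hχ hprim hsum x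
  have hr' : ((r : ℚ) : ℂ) ≠ 0 := by exact_mod_cast hr
  obtain ⟨q, hq⟩ := hcc
  rw [hLC, ← mul_assoc (((r : ℚ) : ℂ)⁻¹), inv_mul_cancel₀ hr', one_mul, hsym,
    show gaussSum χ (ZMod.stdAddChar (N := 8)) / 2 * ((m : ℂ) * ((D'.c : ℂ) *
      modularSymbol (charTwist (64 * N) hN hm hχ D.f) x)) =
      (m : ℂ) * (D'.c : ℂ) * (gaussSum χ (ZMod.stdAddChar (N := 8)) *
        modularSymbol (charTwist (64 * N) hN hm hχ D.f) x) / 2 by ring, hpair, hq]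
  have h1 := zsmul_mem (hkill (x + 1 / 8)) q
  have h2 := zsmul_mem (hkill (x + 3 / 8)) (q * ε)
  rw [zsmul_eq_mul] at h1 h2
  push_cast at h2 ⊢
  rw [show (m : ℂ) * ((D.c : ℂ) * (q : ℂ)) * (2 * (modularSymbol D.f (x + 1 / 8) + (ε : ℂ) * modularSymbol D.f (x + 3 / 8))) / 2
      = (q : ℂ) * ((m : ℂ) * ((D.c : ℂ) * modularSymbol D.f (x + 1 / 8)))
        + (q : ℂ) * (ε : ℂ) * ((m : ℂ) * ((D.c : ℂ) * modularSymbol D.f (x + 3 / 8))) by ring]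
  exact add_mem h1 h2

end Summit.BirchSwinnertonDyer.BirchSwinnertonDyer.Theorems.ManinLocalTwoThreeDyadicDepthSieve

#harness_tags Summit.BirchSwinnertonDyer.BirchSwinnertonDyer.Theorems.ManinLocalTwoThreeDyadicDepthSieve.torsionExponent_transport_of_alignedTwist
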